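import Summits.QuantumFields.BalabanUV.T4Continuum.Support.ShellMeasureExpDuhamelSUN

/-!
# `T4Continuum.ShellMeasureExpDuhamelSUNScope` — the Duhamel integral of `ShellMeasureExpDuhamelSUN` is NORM-SCOPE FREE:
# its entries are scalar integrals, and it equals the same interval integral taken in the `L2Operator` norm scope
(cell `pub-balaban`, sub-cell `t4`, spine estimate NE7c (node U5b); NE7c formalisation swarm, crew seat
`b2b-balaban-t4-ne7c-formalise-leaf-08` gen 6; companion (file 2) of STEP 1 `ShellMeasureExpDuhamelSUN` (p214579) of the
(CH)₁-for-`SU(N)` line; imports that file ONLY; ADDITIVE; 0 `def … : Prop`, 0 sorry, 0 citations; [folklore])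

HONEST FRAMING.  Finite four-torus programme, rung (B)+1 only — NOT infinite volume, NOT a mass gap, NOT the Clay
problem, NOT summit progress.  NE7c NOT PRINTED, NOT PROVED; «NE7c ⇐ the named binders».  Nothing of Bałaban's here.
(CH)₁ for `N ≥ 3` stays DISPLAYED until STEP 2 + (H)∕(AF) + the cone-nullity are all in the tree.

WHY.  `ShellMeasureExpDuhamelSUN.duhamel X H = ∫ r in (0:ℝ)..1, e^{−rX} H e^{rX} dr` is a Bochner integral, whose TERM
carries the `NormedAddCommGroup` instance of `M_N(ℂ)` used to define it (there: the Frobenius scope, the scope of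
`T4AdjointCovarianceUnitary`'s `𝔰𝔲(N)` norm and of the area-formula route (AF)); the determinant file of STEP 2 states
its characterisation `hT` with the integral in the `Matrix.Norms.L2Operator` scope (the scope of `MatrixLog`,
`T4EMLTangentInjective.dexp`).  The two integrals are the same matrix — the value of the integral of a continuous
matrix-valued function does not depend on the (equivalent) norm used to define it — and this file PROVES it in kernel,
entrywise: for each entry `(i, j)` the evaluation `M ↦ M i j` is a continuous linear functional in either scope, so both
integrals have `(i, j)` entry `∫₀¹ (e^{−rX} H e^{rX})_{ij} dr` (`ContinuousLinearMap.intervalIntegral_comp_comm`).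
* `duhamel_apply` — THE SCOPE-FREE CHARACTERISATION `(duhamel X H) i j = ∫ r in (0:ℝ)..1, (adNeg X r H) i j` (scalar
  integrals in `ℂ`);
* `duhamelL2 X H` — the SAME formula with its Bochner integral taken in the `L2Operator` scope
  (`duhamelL2_eq_integral`, `rfl`), `duhamelL2_apply` (its entries), **`duhamel_eq_duhamelL2`**
  (`duhamel X H = duhamelL2 X H`);
* **`genSU_duhT_eq_duhamelL2`** — the chart operator's characterisation in the `L2Operator` scope: STEP 2's `hT` is
  met by `T := duhT v` in either scope (Frobenius: `ShellMeasureExpDuhamelSUN.genSU_duhT_eq_integral`; `L2Operator`: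
  `(genSU_duhT_eq_duhamelL2 v h).trans (duhamelL2_eq_integral _ _)`).
HONEST DEPENDENCY (cell): continuum YM on T⁴ ⇐ BetaPertH ∧ nine spine estimates (0/9 proved); BetaPertH ⇐ (D1) ∧ (D4) ∧
CAP+tail; G-an2-4 gates asym, D1 and NE2/3/4.
-/

noncomputable section

open MeasureTheory Set intervalIntegral

namespace Summit.QuantumFields.BalabanUV.T4Continuum.ShellMeasureExpDuhamelSUNScope

open Literature.MathematicalPhysics.QuantumFieldTheory.Balaban1983to89
open ShellMeasureExpChartSUN ShellMeasureExpDuhamelSUN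

variable {N : ℕ}

/-! ## §1 Entries of the Duhamel integral (Frobenius scope, where `duhamel` lives) -/

section Frob

open scoped Matrix.Norms.Frobenius

/-- the `(i, j)`-entry evaluation of `M_N(ℂ)` as a continuous real-linear functional (Frobenius scope). [folklore] -/
def entryL (i j : Fin N) :=
  LinearMap.toContinuousLinearMap (Matrix.entryLinearMap ℝ ℂ i j : Matrix (Fin N) (Fin N) ℂ →ₗ[ℝ] ℂ)

/-- `entryL i j M = M i j`. [folklore] -/
@[simp] theorem entryL_apply (i j : Fin N) (M : Matrix (Fin N) (Fin N) ℂ) : entryL i j M = M i j := rfl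

/-- **THE SCOPE-FREE CHARACTERISATION OF THE DUHAMEL OPERATOR**: every entry of `T_X H` is the scalar integral of the
corresponding entry of the integrand, `(T_X H)_{ij} = ∫₀¹ (e^{−rX} H e^{rX})_{ij} dr`. [folklore] -/
theorem duhamel_apply (X H : Matrix (Fin N) (Fin N) ℂ) (i j : Fin N) :
    duhamel X H i j = ∫ r in (0:ℝ)..1, adNeg X r H i j := by
  have h := (entryL i j).intervalIntegral_comp_comm ((continuous_adNeg X H).intervalIntegrable (μ := volume) 0 1)
  exact (h.symm : entryL i j (duhamel X H) = _)

end Frob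

/-! ## §2 The same integral in the `L2Operator` scope -/

section L2Op

open scoped Matrix.Norms.L2Operator

/-- the `(i, j)`-entry evaluation as a continuous real-linear functional (`L2Operator` scope). [folklore] -/
def entryL₂ (i j : Fin N) :=
  LinearMap.toContinuousLinearMap (Matrix.entryLinearMap ℝ ℂ i j : Matrix (Fin N) (Fin N) ℂ →ₗ[ℝ] ℂ)

/-- `entryL₂ i j M = M i j`. [folklore] -/
@[simp] theorem entryL₂_apply (i j : Fin N) (M : Matrix (Fin N) (Fin N) ℂ) : entryL₂ i j M = M i j := rfl

/-- THE DUHAMEL INTEGRAL TAKEN IN THE `L2Operator` SCOPE: the same formula `∫₀¹ e^{−rX} H e^{rX} dr`, its Bochner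
integral now elaborated with the `L²`-operator norm of `M_N(ℂ)` (the scope of `MatrixLog` ∕ `T4EMLTangentInjective`).
A configuration (data), equal to `duhamel X H` by `duhamel_eq_duhamelL2`. [folklore] -/
def duhamelL2 (X H : Matrix (Fin N) (Fin N) ℂ) : Matrix (Fin N) (Fin N) ℂ := ∫ r in (0:ℝ)..1, adNeg X r H

/-- `duhamelL2` unfolded to the integrand shape of `ExpDuhamel` (the `L2Operator`-scope integral, by `rfl`).
[folklore] -/
theorem duhamelL2_eq_integral (X H : Matrix (Fin N) (Fin N) ℂ) :
    duhamelL2 X H = ∫ r in (0:ℝ)..1, NormedSpace.exp (-(r • X)) * H * NormedSpace.exp (r • X) := rfl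

/-- entries of the `L2Operator`-scope integral. [folklore] -/
theorem duhamelL2_apply (X H : Matrix (Fin N) (Fin N) ℂ) (i j : Fin N) :
    duhamelL2 X H i j = ∫ r in (0:ℝ)..1, adNeg X r H i j := by
  have h := (entryL₂ i j).intervalIntegral_comp_comm ((continuous_adNeg X H).intervalIntegrable (μ := volume) 0 1)
  exact (h.symm : entryL₂ i j (duhamelL2 X H) = _)

/-- **THE DUHAMEL OPERATOR DOES NOT DEPEND ON THE NORM SCOPE OF ITS BOCHNER INTEGRAL**: the Frobenius-scope
`duhamel X H` of `ShellMeasureExpDuhamelSUN` EQUALS the `L2Operator`-scope integral `duhamelL2 X H` — same entries.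
[folklore] -/
theorem duhamel_eq_duhamelL2 (X H : Matrix (Fin N) (Fin N) ℂ) : duhamel X H = duhamelL2 X H := by
  ext i j
  rw [duhamel_apply, duhamelL2_apply]

/-- **THE CHART OPERATOR's CHARACTERISATION IN THE `L2Operator` SCOPE**:
`genSU (T_v h) = duhamelL2 (genSU v) (genSU h)` (`= ∫₀¹ e^{−r·genSU v} (genSU h) e^{r·genSU v} dr` with the
`L2Operator`-scope integral, `duhamelL2_eq_integral`) — so the determinant file's hypothesis `hT` is met by
`T := duhT v` in EITHER scope (Frobenius: `genSU_duhT_eq_integral`; `L2Operator`: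
`(genSU_duhT_eq_duhamelL2 v h).trans (duhamelL2_eq_integral _ _)`). [folklore] -/
theorem genSU_duhT_eq_duhamelL2 (v h : ChartSU N) : genSU (duhT v h) = duhamelL2 (genSU v) (genSU h) := by
  rw [genSU_duhT, duhamel_eq_duhamelL2]

end L2Op

end Summit.QuantumFields.BalabanUV.T4Continuum.ShellMeasureExpDuhamelSUNScope

end
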